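import Mathlib.Geometry.Manifold.Instances.Sphere
import Mathlib.Geometry.Manifold.MFDeriv.Atlas
import Mathlib.Geometry.Manifold.ContMDiffMFDeriv
import Mathlib.Geometry.Manifold.Diffeomorph
import Mathlib.Analysis.SpecialFunctions.Complex.Circle
import Mathlib.Analysis.Calculus.MeanValue
import HarnessLib

/-!
# Free smooth circle actions: the fundamental vector field does not vanish

General differential topology (topic `Geometry/Manifold`), written for the fact seat of
`Literature.Geometry.Symplectic.exists_symplecticCutPieces_of_isOrigamiForm` (Cannas da Silva–
Guillemin–Pires 2010, Prop. 2.8: unfolding an origami manifold, whose null fibration is a free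
circle action on the fold, `Literature.Geometry.Symplectic.IsOrigamiForm`). A smooth action of the
circle group `Circle` on a manifold `N` (model `𝓡 k`) is given, as in `IsOrigamiForm`, by a map
`θ : Circle → N → N` with `θ 1 = id`, `θ (a * b) = θ a ∘ θ b`, jointly `C^∞`; it is free when
`θ a n = n → a = 1`.

* `contMDiff_circleOrbit`, `contMDiff_circleAct`, `circleActDiffeomorph` — the orbit curves
  `t ↦ θ (exp t) n` and the maps `θ a` are `C^∞`, the latter diffeomorphisms;
* `circleOrbit_eq_act` (equivariance of the orbit curve), `circleOrbitMap_injective` (free ⇒ the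
  orbit map `a ↦ θ a n` is injective);
* `mfderiv_circleOrbit_eq_zero_of_zero` — if the orbit curve has zero velocity at `t = 0` it has
  zero velocity everywhere;
* **`mfderiv_circleOrbit_ne_zero`**, `mfderiv_circleOrbit_apply_one_ne_zero` — for a FREE action
  the fundamental vector `X(n) = d/dt|₀ θ (exp t) n` is non-zero at every point (Lee 2012,
  Prop. 21.7: the orbit map of a free proper action is a smooth embedding; properness is automatic
  for compact groups, Cor. 21.6). Proof: zero velocity everywhere would make the orbit constant
  near `t = 0` (chart at `n`, mean value theorem), so `exp t = 1` for all small `t`.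

Everything is proved; the only definition is the diffeomorphism `circleActDiffeomorph`.
Not here: the quotient manifold `N/S¹` (Lee 2012, Thm. 21.10), for which the tree has the
flow-box/slice template of `Literature/Geometry/Lorentzian/StationaryOrbitSpaceManifold.lean`.

## References

* J. M. Lee, *Introduction to Smooth Manifolds*, 2nd ed., GTM 218, Springer 2012, Cor. 21.6,
  Prop. 21.7, Thm. 21.10 (held: `book:lee2012-introduction-smooth-manifolds`, PDF pp. 573–575).
  [LeeSmoothManifolds2013]
* A. Cannas da Silva, V. Guillemin, A. R. Pires, *Symplectic Origami*, IMRN 2011 =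
  arXiv:0909.4065, Def. 2.2 (null fibration = principal `S¹`-action). [CannasdasilvaGuilleminPires2010]
-/

noncomputable section

open scoped Manifold ContDiff Topology Real
open Set Function

namespace Literature.Geometry.Manifold

variable {k : ℕ} {N : Type*} [TopologicalSpace N] [ChartedSpace (EuclideanSpace ℝ (Fin k)) N]
  [IsManifold (𝓡 k) ∞ N]
  {θ : Circle → N → N}

omit [IsManifold (𝓡 k) ∞ N] in
/-- The orbit curve `t ↦ θ (exp t) n` of a smooth circle action is `C^∞` (`Circle.exp` is `C^∞`,
Mathlib's `contMDiff_circleExp`). [folklore] -/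
theorem contMDiff_circleOrbit
    (hθ : ContMDiff ((𝓡 1).prod (𝓡 k)) (𝓡 k) ∞ (fun p : Circle × N => θ p.1 p.2)) (n : N) :
    ContMDiff 𝓘(ℝ, ℝ) (𝓡 k) ∞ (fun t : ℝ => θ (Circle.exp t) n) :=
  hθ.comp ((contMDiff_circleExp (m := ∞)).prodMk contMDiff_const)

omit [IsManifold (𝓡 k) ∞ N] in
/-- Each map `θ a : N → N` of a smooth circle action is `C^∞`. [folklore] -/
theorem contMDiff_circleAct
    (hθ : ContMDiff ((𝓡 1).prod (𝓡 k)) (𝓡 k) ∞ (fun p : Circle × N => θ p.1 p.2)) (a : Circle) :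
    ContMDiff (𝓡 k) (𝓡 k) ∞ (θ a) :=
  hθ.comp (contMDiff_const.prodMk contMDiff_id)

omit [TopologicalSpace N] [ChartedSpace (EuclideanSpace ℝ (Fin k)) N] [IsManifold (𝓡 k) ∞ N] in
/-- Translation along the orbit: `θ (exp t) n = θ (exp t₀) (θ (exp (t - t₀)) n)` (`exp` is a
homomorphism). [folklore] -/
theorem circleOrbit_eq_act (hmul : ∀ a b n, θ (a * b) n = θ a (θ b n)) (n : N) (t₀ t : ℝ) :
    θ (Circle.exp t) n = θ (Circle.exp t₀) (θ (Circle.exp (t - t₀)) n) := by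
  rw [← hmul, ← Circle.exp_add, add_sub_cancel]

omit [IsManifold (𝓡 k) ∞ N] in
/-- If the orbit curve of a smooth circle action has zero velocity at `t = 0`, it has zero
velocity everywhere (equivariance `γ = θ (exp t₀) ∘ γ ∘ (· - t₀)` and the chain rule). [folklore] -/
theorem mfderiv_circleOrbit_eq_zero_of_zero
    (hθ : ContMDiff ((𝓡 1).prod (𝓡 k)) (𝓡 k) ∞ (fun p : Circle × N => θ p.1 p.2))
    (hmul : ∀ a b n, θ (a * b) n = θ a (θ b n)) (n : N)
    (h0 : mfderiv 𝓘(ℝ, ℝ) (𝓡 k) (fun t : ℝ => θ (Circle.exp t) n) 0 = 0) (t₀ : ℝ) :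
    mfderiv 𝓘(ℝ, ℝ) (𝓡 k) (fun t : ℝ => θ (Circle.exp t) n) t₀ = 0 := by
  have hγ := contMDiff_circleOrbit hθ n
  have h0' : mfderiv 𝓘(ℝ, ℝ) (𝓡 k) (fun t : ℝ => θ (Circle.exp t) n) (t₀ - t₀) = 0 := by
    rw [sub_self]; exact h0
  have hA : HasMFDerivAt 𝓘(ℝ, ℝ) 𝓘(ℝ, ℝ) (fun t : ℝ => t - t₀) t₀
      (ContinuousLinearMap.id ℝ ℝ) :=
    hasMFDerivAt_iff_hasFDerivAt.2 ((hasFDerivAt_id t₀).sub_const t₀)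
  have hB := ((hγ.mdifferentiableAt (by decide)).hasMFDerivAt (x := t₀ - t₀))
  rw [h0'] at hB
  have hC : HasMFDerivAt (𝓡 k) (𝓡 k) (θ (Circle.exp t₀)) (θ (Circle.exp (t₀ - t₀)) n)
      (mfderiv (𝓡 k) (𝓡 k) (θ (Circle.exp t₀)) (θ (Circle.exp (t₀ - t₀)) n)) :=
    ((contMDiff_circleAct hθ _).mdifferentiableAt (by decide)).hasMFDerivAt
  have hcomp := HasMFDerivAt.comp (f := fun t : ℝ => t - t₀) t₀ (hC.comp (t₀ - t₀) hB) hA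
  have hfin := hcomp.congr_of_eventuallyEq
    (Filter.Eventually.of_forall fun t => circleOrbit_eq_act hmul n t₀ t)
  rw [hfin.mfderiv]
  refine ContinuousLinearMap.ext fun v => ?_
  change mfderiv (𝓡 k) (𝓡 k) (θ (Circle.exp t₀)) (θ (Circle.exp (t₀ - t₀)) n) 0 = 0
  exact map_zero _

/-- **A free smooth circle action has non-vanishing fundamental vector field**: the orbit curve
`t ↦ θ (exp t) n` has non-zero differential at `t = 0`. Otherwise it would have zero velocity
everywhere (`mfderiv_circleOrbit_eq_zero_of_zero`), hence be constant near `0` (read in the chart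
at `n`: a map of an interval with zero derivative is constant), so `θ (exp t) n = n` for all small
`t`, and freeness would give `exp t = 1`, i.e. `t ∈ 2πℤ`, for all small `t` — absurd. This is the
infinitesimal form of Lee 2012, Prop. 21.7: for a free (and proper — automatic for the compact
group `S¹`, Cor. 21.6) smooth action the orbit map `θ^{(n)} : G → N` is a smooth embedding, in
particular an immersion. [cite: LeeSmoothManifolds2013, Prop. 21.7] -/
theorem mfderiv_circleOrbit_ne_zero
    (hθ : ContMDiff ((𝓡 1).prod (𝓡 k)) (𝓡 k) ∞ (fun p : Circle × N => θ p.1 p.2))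
    (h1 : ∀ n, θ 1 n = n) (hmul : ∀ a b n, θ (a * b) n = θ a (θ b n))
    (hfree : ∀ a n, θ a n = n → a = 1) (n : N) :
    mfderiv 𝓘(ℝ, ℝ) (𝓡 k) (fun t : ℝ => θ (Circle.exp t) n) 0 ≠ 0 := by
  intro h0
  set γ : ℝ → N := fun t => θ (Circle.exp t) n with hγdef
  have hγ : ContMDiff 𝓘(ℝ, ℝ) (𝓡 k) ∞ γ := contMDiff_circleOrbit hθ n
  have hγ0 : γ 0 = n := by simp [hγdef, h1]
  have hall : ∀ t, mfderiv 𝓘(ℝ, ℝ) (𝓡 k) γ t = 0 :=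
    mfderiv_circleOrbit_eq_zero_of_zero hθ hmul n h0
  -- a small interval mapped into the chart at `n`
  set φ := extChartAt (𝓡 k) n with hφ
  have hU : γ ⁻¹' φ.source ∈ 𝓝 (0 : ℝ) := by
    apply hγ.continuous.continuousAt.preimage_mem_nhds
    rw [hγ0]
    exact extChartAt_source_mem_nhds n
  obtain ⟨δ, hδ, hball⟩ := Metric.mem_nhds_iff.1 hU
  -- the chart expression `g = φ ∘ γ` has zero derivative on the interval
  set g : ℝ → EuclideanSpace ℝ (Fin k) := φ ∘ γ with hg
  have hgd : ∀ t ∈ Metric.ball (0 : ℝ) δ, HasFDerivAt g (0 : ℝ →L[ℝ] EuclideanSpace ℝ (Fin k)) t := by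
    intro t ht
    have hts : γ t ∈ φ.source := hball ht
    have hts' : γ t ∈ (chartAt (EuclideanSpace ℝ (Fin k)) n).source := by
      rwa [← extChartAt_source (I := 𝓡 k)]
    have hγt : MDifferentiableAt 𝓘(ℝ, ℝ) (𝓡 k) γ t := hγ.mdifferentiableAt (by decide)
    have hφt : MDifferentiableAt (𝓡 k) 𝓘(ℝ, EuclideanSpace ℝ (Fin k)) φ (γ t) :=
      mdifferentiableAt_extChartAt hts'
    have hcomp := mfderiv_comp t hφt hγt
    rw [hall t, ContinuousLinearMap.comp_zero] at hcomp
    have hmf : HasMFDerivAt 𝓘(ℝ, ℝ) 𝓘(ℝ, EuclideanSpace ℝ (Fin k)) g t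
        (mfderiv 𝓘(ℝ, ℝ) 𝓘(ℝ, EuclideanSpace ℝ (Fin k)) g t) := (hφt.comp t hγt).hasMFDerivAt
    rw [hcomp] at hmf
    exact hasMFDerivAt_iff_hasFDerivAt.1 hmf
  have hconst : ∀ t ∈ Metric.ball (0 : ℝ) δ, g t = g 0 := by
    intro t ht
    have hdiff : DifferentiableOn ℝ g (Metric.ball (0 : ℝ) δ) :=
      fun u hu => (hgd u hu).differentiableAt.differentiableWithinAt
    refine (convex_ball (0 : ℝ) δ).is_const_of_fderivWithin_eq_zero hdiff ?_ ht
      (Metric.mem_ball_self hδ)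
    intro u hu
    rw [fderivWithin_of_isOpen Metric.isOpen_ball hu]
    exact (hgd u hu).fderiv
  -- hence the orbit is constant near `0`
  have hγconst : ∀ t ∈ Metric.ball (0 : ℝ) δ, γ t = n := by
    intro t ht
    have h := hconst t ht
    simp only [hg, comp_apply] at h
    have := φ.injOn (hball ht) (hball (Metric.mem_ball_self hδ)) h
    rw [this, hγ0]
  -- take `t = min (δ/2) π`: `exp t = 1` forces `t ∈ 2πℤ`, impossible
  set t : ℝ := min (δ / 2) π with ht
  have htpos : 0 < t := lt_min (by linarith) Real.pi_pos
  have htδ : t ∈ Metric.ball (0 : ℝ) δ := by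
    rw [Metric.mem_ball, Real.dist_eq, sub_zero, abs_of_pos htpos]
    exact (min_le_left _ _).trans_lt (by linarith)
  have htπ : t ≤ π := min_le_right _ _
  have hexp : Circle.exp t = 1 := hfree _ n (hγconst t htδ)
  obtain ⟨m, hm⟩ := Circle.exp_eq_one.1 hexp
  have h2π : 0 < 2 * π := by positivity
  rcases le_or_gt m 0 with hm0 | hm0
  · have : (m : ℝ) * (2 * π) ≤ 0 :=
      mul_nonpos_of_nonpos_of_nonneg (by exact_mod_cast hm0) h2π.le
    linarith
  · have hm1 : (1 : ℝ) ≤ m := by exact_mod_cast hm0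
    have : 2 * π ≤ (m : ℝ) * (2 * π) := by nlinarith
    linarith [Real.pi_pos]


/-- **Vector form**: the fundamental vector `X(n) = d/dt|₀ θ (exp t) n` of a free smooth circle
action is non-zero. [cite: LeeSmoothManifolds2013, Prop. 21.7] -/
theorem mfderiv_circleOrbit_apply_one_ne_zero
    (hθ : ContMDiff ((𝓡 1).prod (𝓡 k)) (𝓡 k) ∞ (fun p : Circle × N => θ p.1 p.2))
    (h1 : ∀ n, θ 1 n = n) (hmul : ∀ a b n, θ (a * b) n = θ a (θ b n))
    (hfree : ∀ a n, θ a n = n → a = 1) (n : N) :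
    mfderiv 𝓘(ℝ, ℝ) (𝓡 k) (fun t : ℝ => θ (Circle.exp t) n) 0 (1 : ℝ) ≠ 0 := by
  intro h
  apply mfderiv_circleOrbit_ne_zero hθ h1 hmul hfree n
  refine ContinuousLinearMap.ext_ring ?_
  exact h

omit [TopologicalSpace N] [ChartedSpace (EuclideanSpace ℝ (Fin k)) N] [IsManifold (𝓡 k) ∞ N] in
/-- For a free action the orbit map `a ↦ θ a n` is injective. [folklore] -/
theorem circleOrbitMap_injective (h1 : ∀ n, θ 1 n = n)
    (hmul : ∀ a b n, θ (a * b) n = θ a (θ b n)) (hfree : ∀ a n, θ a n = n → a = 1) (n : N) :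
    Injective fun a : Circle => θ a n := by
  intro a b hab
  change θ a n = θ b n at hab
  have h : θ (b⁻¹ * a) n = n := by
    rw [hmul, hab, ← hmul, inv_mul_cancel, h1]
  have := hfree _ n h
  rwa [inv_mul_eq_one, eq_comm] at this

omit [TopologicalSpace N] [ChartedSpace (EuclideanSpace ℝ (Fin k)) N] [IsManifold (𝓡 k) ∞ N] in
/-- `θ a⁻¹` undoes `θ a`. [folklore] -/
theorem circleAct_inv_apply (h1 : ∀ n, θ 1 n = n) (hmul : ∀ a b n, θ (a * b) n = θ a (θ b n))
    (a : Circle) (n : N) : θ a⁻¹ (θ a n) = n := by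
  rw [← hmul, inv_mul_cancel, h1]

omit [IsManifold (𝓡 k) ∞ N] in
/-- Each map `θ a` of a smooth circle action is a diffeomorphism of `N`, with inverse `θ a⁻¹`.
[folklore] -/
def circleActDiffeomorph
    (hθ : ContMDiff ((𝓡 1).prod (𝓡 k)) (𝓡 k) ∞ (fun p : Circle × N => θ p.1 p.2))
    (h1 : ∀ n, θ 1 n = n) (hmul : ∀ a b n, θ (a * b) n = θ a (θ b n)) (a : Circle) :
    N ≃ₘ⟮𝓡 k, 𝓡 k⟯ N where
  toFun := θ a
  invFun := θ a⁻¹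
  left_inv n := circleAct_inv_apply h1 hmul a n
  right_inv n := by simpa only [inv_inv] using circleAct_inv_apply h1 hmul a⁻¹ n
  contMDiff_toFun := contMDiff_circleAct hθ a
  contMDiff_invFun := contMDiff_circleAct hθ a⁻¹

omit [IsManifold (𝓡 k) ∞ N] in
/-- The diffeomorphism `circleActDiffeomorph` is `θ a`. [folklore] -/
@[simp] theorem coe_circleActDiffeomorph
    (hθ : ContMDiff ((𝓡 1).prod (𝓡 k)) (𝓡 k) ∞ (fun p : Circle × N => θ p.1 p.2))
    (h1 : ∀ n, θ 1 n = n) (hmul : ∀ a b n, θ (a * b) n = θ a (θ b n)) (a : Circle) :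
    ⇑(circleActDiffeomorph hθ h1 hmul a) = θ a := rfl

end Literature.Geometry.Manifold

end
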